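import Mathlib.RingTheory.Derivation.Basic
import Mathlib.Algebra.Algebra.ZMod
import Mathlib.Algebra.Field.ZMod
import Mathlib.RingTheory.Ideal.Span
import Mathlib.Algebra.BigOperators.Fin
import Mathlib.RingTheory.RegularLocalRing.Defs
import Mathlib.Tactic.Ring
import Mathlib.Tactic.LinearCombination
import Literature.AlgebraicGeometry.Resolution.FormalBranchDescent
import HarnessLib

/-!
# Stubs `truncatedExp_kernel`, `stub_truncatedExpParameter` for crux
stmt-ResolutionOfSingularities-15917 (`RadicialJung.CleanModels`, line `Sketch` rev 9.1,
cycle-3 seed "Z1 elementary")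

In characteristic `p`, a derivation `X` of a commutative ring `O` with `X^p = 0` (as an iterated
map) and `X t = 1` is "rectifiable to first order": for every `z` the TRUNCATED EXPONENTIAL
`s := Σ_{i<p} (-t)^i X^i(z) / i!` satisfies `X s = 0` and `s ≡ z (mod t)`.

* `truncatedExp_kernel` — the computation: `X` kills the constants `algebraMap (ZMod p) O c`,
  `X ((-t)^(i+1)) = -(i+1) (-t)^i`, and `(1/(i+1)!) (i+1) = 1/i!` in `ZMod p` for `i + 1 < p`,
  so the derivative of the partial sum `Σ_{i≤n}` telescopes to `(1/n!) (-t)^n X^{n+1} z`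
  (`n < p`); at `n = p - 1` this is `0` because `X^p = 0`. All terms with `i ≥ 1` are multiples
  of `t` and the `i = 0` term is `z`.
* `stub_truncatedExpParameter` — on a `2`-dimensional regular local ring `O` of characteristic
  `p` with `𝔪 = (t₁, t₂)`, the truncated exponential of `t₂` along `t₁` is an `X`-constant
  `s = t₂ + w t₁`; `(t₁, s)` is again a regular system of parameters, so `s ∈ 𝔪 ∖ 𝔪²`
  (`Literature.AlgebraicGeometry.Resolution.not_mem_sq_of_rsop`).
-/

noncomputable section

set_option linter.dupNamespace false

open IsLocalRing

namespace Summit.ResolutionOfSingularities.ResolutionOfSingularities.Theorems.RadicialJung.CleanModels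

universe u

section Kernel

variable {O : Type u} [CommRing O] (p : ℕ) [Fact p.Prime] [Algebra (ZMod p) O]
  (X : Derivation ℤ O O)

/-- A derivation kills the image of `ZMod p` (every element is the cast of a natural number).
[folklore] -/
private theorem X_algebraMap_zmod (a : ZMod p) : X (algebraMap (ZMod p) O a) = 0 := by
  rw [← ZMod.natCast_zmod_val a, map_natCast (algebraMap (ZMod p) O), Derivation.map_natCast]

/-- `X (c y) = c X y` for `c` in the image of `ZMod p`. [folklore] -/
private theorem X_algebraMap_zmod_mul (a : ZMod p) (y : O) :
    X (algebraMap (ZMod p) O a * y) = algebraMap (ZMod p) O a * X y := by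
  rw [Derivation.leibniz, X_algebraMap_zmod, smul_zero, add_zero, smul_eq_mul]

/-- In `ZMod p`, pushed to `O`: `(1/(n+1)!) (n+1) = 1/n!` for `n + 1 < p`. [folklore] -/
private theorem coeff_succ_mul (n : ℕ) (hn : n + 1 < p) :
    algebraMap (ZMod p) O (((n + 1).factorial : ZMod p)⁻¹) * ((n + 1 : ℕ) : O) =
      algebraMap (ZMod p) O ((n.factorial : ZMod p)⁻¹) := by
  have hne : ((n + 1 : ℕ) : ZMod p) ≠ 0 := fun h =>
    Nat.not_dvd_of_pos_of_lt n.succ_pos hn ((ZMod.natCast_eq_zero_iff _ _).1 h)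
  have hc : ((n + 1 : ℕ) : O) = algebraMap (ZMod p) O ((n + 1 : ℕ) : ZMod p) :=
    (map_natCast _ _).symm
  rw [hc, ← map_mul, Nat.factorial_succ, Nat.cast_mul, mul_inv_rev, mul_assoc,
    inv_mul_cancel₀ hne, mul_one]

/-- Derivative of the term of index `n + 1` of the truncated exponential:
`X ((1/(n+1)!) (-t)^(n+1) X^(n+1) z) = (1/(n+1)!) ((-t)^(n+1) X^(n+2) z - (n+1) (-t)^n X^(n+1) z)`.
[folklore] -/
private theorem X_term_succ (t : O) (ht : X t = 1) (z : O) (n : ℕ) :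
    X (algebraMap (ZMod p) O (((n + 1).factorial : ZMod p)⁻¹) * (-t) ^ (n + 1) *
        (⇑X)^[n + 1] z) =
      algebraMap (ZMod p) O (((n + 1).factorial : ZMod p)⁻¹) * (-t) ^ (n + 1) *
          (⇑X)^[n + 1 + 1] z -
        algebraMap (ZMod p) O (((n + 1).factorial : ZMod p)⁻¹) * ((n + 1 : ℕ) : O) *
          (-t) ^ n * (⇑X)^[n + 1] z := by
  rw [Function.iterate_succ_apply' (⇑X) (n + 1) z, mul_assoc, X_algebraMap_zmod_mul,
    Derivation.leibniz, Derivation.leibniz_pow, map_neg, ht]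
  simp only [smul_eq_mul, nsmul_eq_mul, Nat.add_sub_cancel]
  ring

/-- Closed form for the derivative of the partial sums of the truncated exponential:
`X (Σ_{i≤n} (1/i!) (-t)^i X^i z) = (1/n!) (-t)^n X^(n+1) z` for `n < p` (telescoping).
[folklore] -/
private theorem X_partial_sum (t : O) (ht : X t = 1) (z : O) (n : ℕ) (hn : n < p) :
    X (∑ i ∈ Finset.range (n + 1),
        algebraMap (ZMod p) O ((i.factorial : ZMod p)⁻¹) * (-t) ^ i * (⇑X)^[i] z) =
      algebraMap (ZMod p) O ((n.factorial : ZMod p)⁻¹) * (-t) ^ n * (⇑X)^[n + 1] z := by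
  induction n with
  | zero =>
    simp only [zero_add, Finset.sum_range_one, Nat.factorial_zero, Nat.cast_one, inv_one,
      map_one, pow_zero, one_mul, Function.iterate_zero_apply, Function.iterate_one]
  | succ n ih =>
    rw [Finset.sum_range_succ, map_add, ih ((Nat.lt_succ_self n).trans hn),
      X_term_succ p X t ht z n, ← coeff_succ_mul p n hn]
    ring

/-- **Truncated exponential.** For a derivation `X` of a commutative ring `O` of characteristic
`p` with `X^p = 0` and `X t = 1`, the truncated exponential `Σ_{i<p} (1/i!) (-t)^i X^i z` is an
`X`-constant congruent to `z` modulo `t`. [folklore] -/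
theorem truncatedExp_kernel {O : Type u} [CommRing O] (p : ℕ) [Fact p.Prime] [CharP O p]
    [Algebra (ZMod p) O] (X : Derivation ℤ O O) (hXp : ∀ z : O, ((X : O → O)^[p]) z = 0)
    (t : O) (ht : X t = 1) (z : O) :
    X (∑ i : Fin p, algebraMap (ZMod p) O (((i : ℕ).factorial : ZMod p)⁻¹) * (-t) ^ (i : ℕ) *
        ((X : O → O)^[(i : ℕ)]) z) = 0 ∧
      (∑ i : Fin p, algebraMap (ZMod p) O (((i : ℕ).factorial : ZMod p)⁻¹) * (-t) ^ (i : ℕ) *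
          ((X : O → O)^[(i : ℕ)]) z) - z ∈ Ideal.span {t} := by
  have hp : p.Prime := Fact.out
  obtain ⟨q, rfl⟩ : ∃ q, p = q + 1 := Nat.exists_eq_succ_of_ne_zero hp.ne_zero
  rw [Fin.sum_univ_eq_sum_range (fun i => algebraMap (ZMod (q + 1)) O
    ((i.factorial : ZMod (q + 1))⁻¹) * (-t) ^ i * (⇑X)^[i] z) (q + 1)]
  refine ⟨?_, ?_⟩
  · rw [X_partial_sum (q + 1) X t ht z q q.lt_succ_self, hXp, mul_zero]
  · rw [Finset.sum_range_succ']
    simp only [Nat.factorial_zero, Nat.cast_one, inv_one, map_one, pow_zero, one_mul,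
      Function.iterate_zero_apply, add_sub_cancel_right]
    refine Ideal.sum_mem (Ideal.span {t}) fun i _ => Ideal.mem_span_singleton.2 ?_
    exact dvd_mul_of_dvd_left
      (dvd_mul_of_dvd_right (dvd_pow (dvd_neg.2 dvd_rfl) i.succ_ne_zero) _) _

end Kernel

/-- If `𝔪 = (t₁, t₂)` in a `2`-dimensional regular local ring, then `t₂ + w t₁ ∈ 𝔪 ∖ 𝔪²`
(`(t₁, t₂ + w t₁)` is again a regular system of parameters). [folklore] -/
private theorem add_mul_mem_not_mem_sq {O : Type u} [CommRing O] [IsRegularLocalRing O]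
    (hd : ringKrullDim O = (2 : WithBot ℕ∞)) (t₁ t₂ w : O)
    (ht : Ideal.span {t₁, t₂} = maximalIdeal O) :
    t₂ + w * t₁ ∈ maximalIdeal O ∧ t₂ + w * t₁ ∉ maximalIdeal O ^ 2 := by
  have hspan : Ideal.span (Set.range ![t₁, t₂ + w * t₁]) = maximalIdeal O := by
    rw [Literature.AlgebraicGeometry.Resolution.ideal_span_range_fin_two, Matrix.cons_val_zero,
      Matrix.cons_val_one, Matrix.cons_val_fin_one, Ideal.span_pair_add_mul_left, ht]
  have hd' : ringKrullDim O = ((2 : ℕ) : WithBot ℕ∞) := by rw [hd]; rfl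
  refine ⟨?_, ?_⟩
  · rw [← ht]
    exact Ideal.mem_span_pair.2 ⟨w, 1, by ring⟩
  · have h := Literature.AlgebraicGeometry.Resolution.not_mem_sq_of_rsop _ hspan hd' 1
    rwa [Matrix.cons_val_one, Matrix.cons_val_fin_one] at h

/-- **A p-nilpotent derivation transversal to a parameter has a regular parameter as constant.**
On a `2`-dimensional regular local ring `O` of characteristic `p` with `𝔪 = (t₁, t₂)`, a
derivation `X` with `X^p = 0` and `X t₁ = 1` kills some `s ∈ 𝔪 ∖ 𝔪²`: the truncated exponential
`s = Σ_{i<p} (1/i!) (-t₁)^i X^i t₂ ≡ t₂ (mod t₁)` of `truncatedExp_kernel`. [folklore] -/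
theorem stub_truncatedExpParameter {O : Type u} [CommRing O] [IsRegularLocalRing O] (p : ℕ)
    [Fact p.Prime] [CharP O p] (hd : ringKrullDim O = (2 : WithBot ℕ∞)) (t₁ t₂ : O)
    (ht : Ideal.span {t₁, t₂} = IsLocalRing.maximalIdeal O) (X : Derivation ℤ O O)
    (hXp : ∀ z : O, ((X : O → O)^[p]) z = 0) (ht₁ : X t₁ = 1) :
    ∃ s : O, X s = 0 ∧ s ∈ IsLocalRing.maximalIdeal O ∧ s ∉ IsLocalRing.maximalIdeal O ^ 2 := by
  letI : Algebra (ZMod p) O := ZMod.algebra O p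
  obtain ⟨hXs, hst⟩ := truncatedExp_kernel p X hXp t₁ ht₁ t₂
  obtain ⟨w, hw⟩ := Ideal.mem_span_singleton.1 hst
  obtain ⟨h₁, h₂⟩ := add_mul_mem_not_mem_sq hd t₁ t₂ w ht
  refine ⟨_, hXs, ?_, ?_⟩
  · convert h₁ using 1
    linear_combination hw
  · convert h₂ using 2
    linear_combination hw

end Summit.ResolutionOfSingularities.ResolutionOfSingularities.Theorems.RadicialJung.CleanModels
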